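import Literature.NumberTheory.EllipticCurves.WeilPairingLevelDescent
import Literature.NumberTheory.EllipticCurves.SelmerProofs
import Literature.NumberTheory.EllipticCurves.SelmerImage
import Literature.NumberTheory.EllipticCurves.SelmerCorankAssembly
import Literature.NumberTheory.EllipticCurves.KummerSelmerStructure
import HarnessLib

/-!
# Multiplication by `k` on Selmer groups: `[k]_* Sel^{(kd)}(E/K) ⊆ Sel^{(d)}(E/K) ∩ κ_d(E(K))` as soon as `k · Ш(E/K)[kd] = 0`,
# and `#(Sel^{(d)} ∩ ker(H¹(K,E[d]) → H¹(K,E))) = [E(K) : d E(K)]`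
# (route `KatoDescentPotSupersingular` / `…Tame…`, crux M = stmt-BirchSwinnertonDyer-19196; route-free helper)

Seat `bsd-potss-rkm` g19 (prover; cell `bsd-potss`), item stmt-BirchSwinnertonDyer-19196 (`--supports … --as helper`; closes
nothing).  HONEST FRAMING: BSD is not proved by any of this; nothing is booked; theorems only (no definition, no named fact):
TOOL theorems on Selmer groups of elliptic curves over number fields.

## Why (companion (ii) of brick (a) of crux M's level-0 ledger — memo `HOME/rkm/FINDING-19196-rkm-g19.md` §"What remains", step P4)

The Poitou–Tate cokernel of `S(E[p^∞]) → ⊕_{ℓ≠p} H¹_ur(ℚ_ℓ, E[p^∞])` is controlled by the image, at level `p^K`, of the dual Selmer group of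
level `p^{K+s}`; through the Weil transports that image is `[p^s]_* Sel^{(p^{K+s})}(E/ℚ)` (part 40), and THIS file shows it consists of
Kummer classes of rational points — a group of order `[E(ℚ) : p^K E(ℚ)]` (`= #E(ℚ)[p^∞]` in rank `0`) — once `p^s` kills `Ш(E/ℚ)[p^∞]`.
Generic over a number field `K`, levels `d` and `kd` (`mulK W k d : E[kd] → E[d]`, `P ↦ k·P`):

* `torsionH1ToH1_map_mulK` — `(E[d] ↪ E)_* [k]_* c = k · (E[kd] ↪ E)_* c` in `H¹(K, E)` (cocycle-level);
* `map_mulK_mem_selmerGroup` — `[k]_* Sel^{(kd)} ⊆ Sel^{(d)}` (both Selmer groups are preimages of `Ш`-local kernels under `(E[·] ↪ E)_*`,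
  `selmerLocalKer_eq_comap`);
* **`map_mulK_mem_selmerGroup_inf_ker`** — if `k · a = 0` for every `a ∈ Ш(E/K)` with `kd · a = 0`, then `[k]_* Sel^{(kd)} ⊆ Sel^{(d)} ⊓ ker (E[d] ↪ E)_*`
  (`(E[kd] ↪ E)_* Sel^{(kd)} = Ш[kd]`, `map_torsionH1ToH1_selmerGroup`); `map_mulK_selmerGroup_le`: the subgroup form;
* **`natCard_selmerGroup_inf_ker_torsionH1ToH1`** — `#(Sel^{(d)} ⊓ ker (E[d] ↪ E)_*) = [E(K) : d·E(K)]` (the Kummer map: `exists_kummerMap`).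

References: J. H. Silverman, *AEC* VIII §2 (Kummer sequence), X.4.2 [SilvermanAEC2009]; J. S. Milne, *ADT* I §6 [MilneADT2006]; K. Kato,
Astérisque 295, proof of Prop. 14.16 (pp. 244–245) [Kato2004Asterisque].
-/

-- the summit and its single problem are both named `BirchSwinnertonDyer` (registry layout D-0017)
set_option linter.dupNamespace false
set_option autoImplicit false

noncomputable section

open scoped Classical ContRepresentation NumberField
open CategoryTheory Function Field NumberField IsDedekindDomain WeierstrassCurve
open Literature.NumberTheory.GaloisRepresentations Literature.NumberTheory.EllipticCurves

universe u

namespace Summit.BirchSwinnertonDyer.BirchSwinnertonDyer.Theorems.KatoFiniteLevelCount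

section MulK

variable {K : Type u} [Field K] (W : WeierstrassCurve K) (k d : ℕ)

/-- **`(E[d] ↪ E)_* ([k]_* c) = k · (E[kd] ↪ E)_* c` in `H¹(K, E)`** for every `c ∈ H¹(K, E[kd])`: on cocycles both are
`g ↦ k · c(g)` read in `E(K̄)` (`coe_mulK_apply`). [cite: SilvermanAEC2009, VIII §2] -/
theorem torsionH1ToH1_map_mulK (c : galoisCohomology (W.torsionGaloisModule ((k * d : ℕ) : ℤ)) 1) :
    torsionH1ToH1 W (d : ℤ) (galoisCohomology.map (mulK W k d) 1 c) =
      k • torsionH1ToH1 W ((k * d : ℕ) : ℤ) c := by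
  obtain ⟨φ, rfl⟩ := oneCocycleClass_surjective _ c
  rw [galoisCohomology.map_one_oneCocycleClass, torsionH1ToH1_eq_resH1Hom, torsionH1ToH1_eq_resH1Hom]
  erw [resH1Hom_id_oneCocycleClass, resH1Hom_id_oneCocycleClass]
  rw [← Nat.cast_smul_eq_nsmul ℤ, ← oneCocycleClass_smul]
  refine congrArg _ (Subtype.ext (ContinuousMap.ext fun g ↦ ?_))
  change ((mulK W k d (φ.1 g) : geomTorsion W (d : ℤ)) : geomPoints W) = (k : ℤ) • ((φ.1 g : geomTorsion W ((k * d : ℕ) : ℤ)) : geomPoints W)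
  exact coe_mulK_apply W k d (φ.1 g)

variable [NumberField K]

/-- **`[k]_* Sel^{(kd)}(E/K) ⊆ Sel^{(d)}(E/K)`**: the local Selmer kernels are the preimages of `ker(H¹(K,E) → H¹(K_v,E))` under
`(E[·] ↪ E)_*` (`selmerLocalKer_eq_comap`), and `(E[d] ↪ E)_* [k]_* = k·(E[kd] ↪ E)_*`. [cite: SilvermanAEC2009, X.§4 diagram (**)] -/
theorem map_mulK_mem_selmerGroup {c : galoisCohomology (W.torsionGaloisModule ((k * d : ℕ) : ℤ)) 1}
    (hc : c ∈ selmerGroup W ((k * d : ℕ) : ℤ)) :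
    galoisCohomology.map (mulK W k d) 1 c ∈ selmerGroup W (d : ℤ) := by
  have hc' := (mem_selmerGroup_iff W ((k * d : ℕ) : ℤ) c).mp hc
  have key : ∀ (E : Type u) [Field E] [Algebra K E], c ∈ selmerLocalKer W E ((k * d : ℕ) : ℤ) →
      galoisCohomology.map (mulK W k d) 1 c ∈ selmerLocalKer W E (d : ℤ) := by
    intro E _ _ h
    rw [W.selmerLocalKer_eq_comap E] at h ⊢
    have h2 : torsionH1ToH1 W ((k * d : ℕ) : ℤ) c ∈ W.localRestrictionKer E := h
    change torsionH1ToH1 W (d : ℤ) (galoisCohomology.map (mulK W k d) 1 c) ∈ W.localRestrictionKer E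
    rw [torsionH1ToH1_map_mulK]
    exact AddSubgroup.nsmul_mem _ h2 k
  exact (mem_selmerGroup_iff W (d : ℤ) _).mpr ⟨fun v => key _ (hc'.1 v), fun w => key _ (hc'.2 w)⟩

/-- **`[k]_* Sel^{(kd)} ⊆ ker (E[d] ↪ E)_*` when `k` kills `Ш(E/K)[kd]`**: `(E[kd] ↪ E)_*` maps `Sel^{(kd)}` into `Ш(E/K)[kd]`
(`map_torsionH1ToH1_selmerGroup`), and `(E[d] ↪ E)_* [k]_* c = k · (E[kd] ↪ E)_* c = 0`. [cite: SilvermanAEC2009, Thm. X.4.2 (a)] -/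
theorem torsionH1ToH1_map_mulK_eq_zero_of_sha [NeZero k] [NeZero d]
    (hk : ∀ a ∈ W.sha, (((k * d : ℕ) : ℤ)) • a = 0 → k • a = 0)
    {c : galoisCohomology (W.torsionGaloisModule ((k * d : ℕ) : ℤ)) 1} (hc : c ∈ selmerGroup W ((k * d : ℕ) : ℤ)) :
    torsionH1ToH1 W (d : ℤ) (galoisCohomology.map (mulK W k d) 1 c) = 0 := by
  have hn : ((k * d : ℕ) : ℤ) ≠ 0 := Int.natCast_ne_zero.mpr (NeZero.ne (k * d))
  have h : torsionH1ToH1 W ((k * d : ℕ) : ℤ) c ∈ (selmerGroup W ((k * d : ℕ) : ℤ)).map (torsionH1ToH1 W ((k * d : ℕ) : ℤ)) :=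
    ⟨c, hc, rfl⟩
  rw [W.map_torsionH1ToH1_selmerGroup_holds hn] at h
  rw [torsionH1ToH1_map_mulK]
  exact hk _ h.1 h.2

/-- **`[k]_* Sel^{(kd)}(E/K) ≤ Sel^{(d)}(E/K) ⊓ ker (E[d] ↪ E)_*`** (the latter `= κ_d(E(K))`, the Kummer image, by `exists_kummerMap`) as soon as
`k · Ш(E/K)[kd] = 0` — with `k = p^s ≥ exp Ш[p^∞]`, `d = p^K`: the level-`p^{K+s}` Selmer classes come down to Kummer classes of rational points.
[cite: SilvermanAEC2009, VIII §2 and Thm. X.4.2 (a)] [cite: Kato2004Asterisque, proof of Prop. 14.16 (pp. 244–245)] -/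
theorem map_mulK_selmerGroup_le [NeZero k] [NeZero d]
    (hk : ∀ a ∈ W.sha, (((k * d : ℕ) : ℤ)) • a = 0 → k • a = 0) :
    (selmerGroup W ((k * d : ℕ) : ℤ)).map (galoisCohomology.map (mulK W k d) 1) ≤
      selmerGroup W (d : ℤ) ⊓ (torsionH1ToH1 W (d : ℤ)).ker := by
  rintro _ ⟨c, hc, rfl⟩
  exact ⟨map_mulK_mem_selmerGroup W k d hc,
    (AddMonoidHom.mem_ker).2 (torsionH1ToH1_map_mulK_eq_zero_of_sha W k d hk hc)⟩

omit [NumberField K] in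
/-- **`#(Sel^{(n)}(E/K) ⊓ ker (E[n] ↪ E)_*) = [E(K) : n E(K)]`** (`n ≠ 0`): this intersection is the image of the Kummer map
`κ : E(K) → H¹(K, E[n])`, whose kernel is `n E(K)` (tree `exists_kummerMap`). Both sides are `0` when infinite.
[cite: SilvermanAEC2009, VIII §2 (the Kummer sequence)] -/
theorem natCard_selmerGroup_inf_ker_torsionH1ToH1 [NumberField K] {n : ℤ} (hn : n ≠ 0) :
    Nat.card ↥(selmerGroup W n ⊓ (torsionH1ToH1 W n).ker) = (zsmulAddGroupHom n : W.toAffine.Point →+ _).range.index := by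
  obtain ⟨κ, hker, hrange⟩ := W.exists_kummerMap_holds hn
  rw [← hrange, ← hker, AddSubgroup.index_ker]

end MulK

end Summit.BirchSwinnertonDyer.BirchSwinnertonDyer.Theorems.KatoFiniteLevelCount

end
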